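import Mathlib
import Summits.KontsevichZagierPeriods.Zeta5Search.Families.CellularBZRecordDecayRate
import Summits.KontsevichZagierPeriods.Zeta5Search.Brown8.RecordQRateWindow
import HarnessLib

/-!
# ζ(5) search — the Brown–Zudilin record rates `record_rates` ARE A THEOREM (fam-brown8 g8, capstone)

HONEST FRAMING: systematic search; no irrationality claim unless certified. The statement below is about the sizes of
Brown–Zudilin's record linear forms and their integer coefficients [arXiv:2210.03391, Sect. 11]; by their own account
these sizes are far too weak for irrationality (`γ = 0.86597…` needs the arithmetic of `Φₙ`, not addressed here), and
nothing in this file bears on `ζ(5)`.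

OUR work (Summit side). The Literature NAMED FACT `BrownZudilin2022.record_rates` (`GeneralFamily.lean`; printed
numerically in the paper, reproduced numerically in this programme, never before a theorem in the tree) is the
conjunction of
* the decay rate of the cellular integral on the record ray: `∃ c ∈ (−66.05784568, −66.05784567), log|I(a·n)|/n → c`
  — `Families/CellularBZRecordDecayRate.record_rates_integral` (sup-of-integrand law F36 + a kernel-checked
  weight-7560 transport certificate for `bzSup a` over P2's F45);
* the growth rate of the coefficients `Q(a·n)`: `∃ c ∈ (85.08768883, 85.08768884), log|Q(a·n)|/n → c`
  — `Brown8/RecordQRateWindow.record_rates_Q` (supermultiplicativity of the summands of (17) + Fekete's lemma for the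
  existence; certifier 2's Chernoff / Stirling brackets, strict, for the window).
-/

namespace Summit.KontsevichZagierPeriods.Zeta5Search.Brown8

/-- **[Brown–Zudilin 2022, Sect. 11, the record rates] as a THEOREM**: the named fact `record_rates` holds. -/
theorem record_rates_holds : Literature.NumberTheory.Irrationality.BrownZudilin2022.record_rates :=
  Families.Cellular.record_rates_of_Q record_rates_Q

end Summit.KontsevichZagierPeriods.Zeta5Search.Brown8
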